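import Summits.HubbardSuperconductivity.HubbardSuperconductivity.Theorems.DeformationLadderApproximatingHamiltonianGCSourcedExpect

/-!
# Route `DeformationLadder`, item `ApproximatingHamiltonianGC` (stmt-HubbardSuperconductivity-1895):
# sub-additivity of the grand-canonical ground energy of a PAIR-SOURCED Hubbard Hamiltonian under a cut

Support file (`--supports stmt-HubbardSuperconductivity-1895`). For the pair-sourced Hubbard
Hamiltonians `H_{G,W} = hamiltonianWith G t U μ − Σ_{p,q} W(p,q) (b_{pq} + b_{pq}ᴴ)` of
`…SourcedExpect.lean` (real pair weight `W`, singlet bond pairs `b_{pq}`), the source breaks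
particle number, so the sector-wise cut lemma `groundEnergyAt_le_add_of_cut` of the tree does
not apply; the FULL Fock-space ground energy `Matrix.groundEnergy` is estimated directly with
the graded tensor product `ψ₁ ⊗ ψ₂` of block trial states:

* `dlsc_groundEnergy_le_add_of_cut`: if the site set of `G` is the ordered disjoint union of those
  of `G₁`, `G₂` (strictly monotone `e₁ < e₂`, covering), adjacency and weights agree inside the
  blocks, `|W| ≤ w`, and at most `k` ordered cross pairs are adjacent / carry a weight (each way),
  then `E₀(H_{G,W}) ≤ E₀(H_{G₁,W₁}) + E₀(H_{G₂,W₂}) + (4|t| + 8w)k`. Terms inside a block reproduce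
  the block expectations; cross terms are NOT claimed to vanish (the block states have no definite
  particle number) but are bounded (`≤ 2|t|`, `≤ 4w` each) and counted.
* `dlsc_groundEnergy_le_of_mismatch`: on a common site set, two such Hamiltonians whose
  adjacencies differ on `≤ k` ordered pairs and whose weights differ (by `≤ w`) on `≤ k` ordered
  pairs have ground energies within `(2|t| + 4w)k` (trial state = a near ground state of the other).

Ruelle, *Statistical Mechanics: Rigorous Results* (1969) §2 (thermodynamic limit by
sub-additivity), here for lattice fermions with a pair source. No definitions are introduced.
-/

set_option linter.dupNamespace false

noncomputable section

namespace Summit.HubbardSuperconductivity.HubbardSuperconductivity.Theorems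

open Matrix Finset Literature.MathematicalPhysics.QuantumLattice
open Literature.MathematicalPhysics.QuantumLattice.ThermodynamicLimit
open Literature.Barriers.HubbardSuperconductivity (bondPair bondPair_conjTranspose norm_bondPair_le_two)
open scoped ComplexOrder Matrix.Norms.L2Operator

/-! ### The cut estimate -/

section Cut

variable {Λ₁ Λ₂ Λ : Type*} [LinearOrder Λ₁] [Fintype Λ₁] [LinearOrder Λ₂] [Fintype Λ₂]
  [LinearOrder Λ] [Fintype Λ]

variable (G₁ : SimpleGraph Λ₁) (G₂ : SimpleGraph Λ₂) (G : SimpleGraph Λ) [DecidableRel G₁.Adj]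
  [DecidableRel G₂.Adj] [DecidableRel G.Adj]

/-- **Almost-subadditivity of the ground energy of a pair-sourced Hubbard Hamiltonian under a cut.**
Let the sites of `G` be the ordered disjoint union of those of `G₁` (below, along `e₁`) and `G₂`
(above, along `e₂`), with the adjacency of `G` and the pair weight `W` restricting EXACTLY to
`Gᵢ`, `Wᵢ` on the blocks; let `|W| ≤ w`, and let at most `k` ordered cross pairs (each
orientation) be adjacent, resp. carry a non-zero weight. Then
`E₀(H_{G,W}) ≤ E₀(H_{G₁,W₁}) + E₀(H_{G₂,W₂}) + (4|t| + 8w)k` for the pair-sourced Hamiltonians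
`H_{G,W} = hamiltonianWith G t U μ − Σ_{p,q} W(p,q)(b_{pq} + b_{pq}ᴴ)`.
Proof: graded tensor product `ψ₁ ⊗ ψ₂` of unit near ground states of the blocks as the trial
vector; block terms factorise; the `≤ 4k` cross terms are bounded by `2|t|` (hopping) and `4w`
(pairs) each. Ruelle (1969) §2, for lattice fermions with a pair source. [folklore] -/
theorem dlsc_groundEnergy_le_add_of_cut {e₁ : Λ₁ → Λ} {e₂ : Λ₂ → Λ} (he₁ : StrictMono e₁)
    (he₂ : StrictMono e₂) (h12 : ∀ x y, e₁ x < e₂ y) (hcov : ∀ z, (∃ x, e₁ x = z) ∨ ∃ y, e₂ y = z)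
    (hG₁ : ∀ x x', G.Adj (e₁ x) (e₁ x') ↔ G₁.Adj x x')
    (hG₂ : ∀ y y', G.Adj (e₂ y) (e₂ y') ↔ G₂.Adj y y')
    (W : Λ → Λ → ℝ) (W₁ : Λ₁ → Λ₁ → ℝ) (W₂ : Λ₂ → Λ₂ → ℝ)
    (hW₁ : ∀ x x', W (e₁ x) (e₁ x') = W₁ x x') (hW₂ : ∀ y y', W (e₂ y) (e₂ y') = W₂ y y')
    {w : ℝ} (hw0 : 0 ≤ w) (hw : ∀ p q, |W p q| ≤ w) {k : ℕ}
    (hkG : #{pq : Λ₁ × Λ₂ | G.Adj (e₁ pq.1) (e₂ pq.2)} ≤ k)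
    (hkG' : #{qp : Λ₂ × Λ₁ | G.Adj (e₂ qp.1) (e₁ qp.2)} ≤ k)
    (hkW : #{pq : Λ₁ × Λ₂ | W (e₁ pq.1) (e₂ pq.2) ≠ 0} ≤ k)
    (hkW' : #{qp : Λ₂ × Λ₁ | W (e₂ qp.1) (e₁ qp.2) ≠ 0} ≤ k) (t U μ : ℝ) :
    (hamiltonianWith G t U μ -
        ∑ p : Λ, ∑ q : Λ, ((W p q : ℝ) : ℂ) • (bondPair p q + (bondPair p q)ᴴ)).groundEnergy ≤
      (hamiltonianWith G₁ t U μ -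
        ∑ x : Λ₁, ∑ x' : Λ₁, ((W₁ x x' : ℝ) : ℂ) • (bondPair x x' + (bondPair x x')ᴴ)).groundEnergy +
      (hamiltonianWith G₂ t U μ -
        ∑ y : Λ₂, ∑ y' : Λ₂, ((W₂ y y' : ℝ) : ℂ) • (bondPair y y' + (bondPair y y')ᴴ)).groundEnergy +
      (4 * |t| + 8 * w) * k := by
  -- orbital maps
  set O₁ : Orb Λ₁ → Orb Λ := fun p => orb (e₁ (ofLex p).1) (ofLex p).2 with hO₁
  set O₂ : Orb Λ₂ → Orb Λ := fun q => orb (e₂ (ofLex q).1) (ofLex q).2 with hO₂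
  have hO₁m : StrictMono O₁ := strictMono_orbMap he₁
  have hO₂m : StrictMono O₂ := strictMono_orbMap he₂
  have hO12 : ∀ p q, O₁ p < O₂ q := orbMap_lt_orbMap h12
  have hOcov : ∀ r, (∃ p, O₁ p = r) ∨ ∃ q, O₂ q = r := orbMap_cover hcov
  have hOne : ∀ p q, O₁ p ≠ O₂ q := fun p q => (hO12 p q).ne
  have he₁i : Function.Injective e₁ := he₁.injective
  have he₂i : Function.Injective e₂ := he₂.injective
  have hene : ∀ x y, e₁ x ≠ e₂ y := fun x y => (h12 x y).ne
  have hHS := dlsc_isHermitian_sourced G W t U μ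
  have hHS₁ := dlsc_isHermitian_sourced G₁ W₁ t U μ
  have hHS₂ := dlsc_isHermitian_sourced G₂ W₂ t U μ
  -- the estimate for product trial states
  have main : ∀ (ψ₁ : Fock (Orb Λ₁)) (ψ₂ : Fock (Orb Λ₂)),
      star ψ₁ ⬝ᵥ ψ₁ = 1 → star ψ₂ ⬝ᵥ ψ₂ = 1 →
      (hamiltonianWith G t U μ -
        ∑ p : Λ, ∑ q : Λ, ((W p q : ℝ) : ℂ) • (bondPair p q + (bondPair p q)ᴴ)).groundEnergy ≤
        (star ψ₁ ⬝ᵥ ((hamiltonianWith G₁ t U μ -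
          ∑ x : Λ₁, ∑ x' : Λ₁, ((W₁ x x' : ℝ) : ℂ) • (bondPair x x' + (bondPair x x')ᴴ)) *ᵥ ψ₁)).re +
        (star ψ₂ ⬝ᵥ ((hamiltonianWith G₂ t U μ -
          ∑ y : Λ₂, ∑ y' : Λ₂, ((W₂ y y' : ℝ) : ℂ) • (bondPair y y' + (bondPair y y')ᴴ)) *ᵥ ψ₂)).re +
        (4 * |t| + 8 * w) * k := by
    intro ψ₁ ψ₂ hψ₁ hψ₂
    set Ψ : Fock (Orb Λ) := fun s => ψ₁ {p | O₁ p ∈ s} * ψ₂ {q | O₂ q ∈ s} with hΨ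
    have hΨ1 : star Ψ ⬝ᵥ Ψ = 1 := by
      rw [hΨ, dotProduct_prodVec hO₁m.injective hO₂m.injective hOne hOcov, hψ₁, hψ₂, one_mul]
    have hE := groundEnergy_le_rayleigh_holds hHS Ψ hΨ1
    -- block amplitudes
    set F₁ : Λ₁ → Λ₁ → Fin 2 → ℂ := fun x x' σ =>
      star (annihilation (orb x σ) *ᵥ ψ₁) ⬝ᵥ (annihilation (orb x' σ) *ᵥ ψ₁) with hF₁
    set F₂ : Λ₂ → Λ₂ → Fin 2 → ℂ := fun y y' σ =>
      star (annihilation (orb y σ) *ᵥ ψ₂) ⬝ᵥ (annihilation (orb y' σ) *ᵥ ψ₂) with hF₂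
    set D₁ : Λ₁ → ℂ := fun x => star ψ₁ ⬝ᵥ (numberOp x 0 *ᵥ (numberOp x 1 *ᵥ ψ₁)) with hD₁
    set D₂ : Λ₂ → ℂ := fun y => star ψ₂ ⬝ᵥ (numberOp y 0 *ᵥ (numberOp y 1 *ᵥ ψ₂)) with hD₂
    set P₁ : Λ₁ → Λ₁ → ℂ := fun x x' => star ψ₁ ⬝ᵥ (bondPair x x' *ᵥ ψ₁) with hP₁
    set P₂ : Λ₂ → Λ₂ → ℂ := fun y y' => star ψ₂ ⬝ᵥ (bondPair y y' *ᵥ ψ₂) with hP₂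
    -- amplitudes of the product vector reduce to block amplitudes
    have hF11 : ∀ x x' σ, star (annihilation (orb (e₁ x) σ) *ᵥ Ψ) ⬝ᵥ
        (annihilation (orb (e₁ x') σ) *ᵥ Ψ) = F₁ x x' σ := by
      intro x x' σ
      have h := dotProduct_annihilation_low_low hO₁m hO₂m hO12 hOcov ψ₁ ψ₂ (orb x σ) (orb x' σ)
      rw [hψ₂, mul_one] at h
      exact h
    have hF22 : ∀ y y' σ, star (annihilation (orb (e₂ y) σ) *ᵥ Ψ) ⬝ᵥ
        (annihilation (orb (e₂ y') σ) *ᵥ Ψ) = F₂ y y' σ := by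
      intro y y' σ
      have h := dotProduct_annihilation_high_high hO₁m hO₂m hO12 hOcov ψ₁ ψ₂ (orb y σ) (orb y' σ)
      rw [hψ₁, one_mul] at h
      exact h
    have hD1 : ∀ x, star Ψ ⬝ᵥ (numberOp (e₁ x) 0 *ᵥ (numberOp (e₁ x) 1 *ᵥ Ψ)) = D₁ x := by
      intro x
      have h := dotProduct_numberAt_numberAt_low hO₁m hO₂m hO12 hOcov ψ₁ ψ₂ (orb x 0) (orb x 1)
      rw [hψ₂, mul_one] at h
      exact h
    have hD2 : ∀ y, star Ψ ⬝ᵥ (numberOp (e₂ y) 0 *ᵥ (numberOp (e₂ y) 1 *ᵥ Ψ)) = D₂ y := by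
      intro y
      have h := dotProduct_numberAt_numberAt_high hO₁m hO₂m hO12 hOcov ψ₁ ψ₂ (orb y 0) (orb y 1)
      rw [hψ₁, one_mul] at h
      exact h
    have hP11 : ∀ x x', star Ψ ⬝ᵥ (bondPair (e₁ x) (e₁ x') *ᵥ Ψ) = P₁ x x' := by
      intro x x'
      have ha := dlsc_dotProduct_pair_low hO₁m hO₂m hO12 hOcov ψ₁ ψ₂ (orb x 0) (orb x' 1)
      have hb := dlsc_dotProduct_pair_low hO₁m hO₂m hO12 hOcov ψ₁ ψ₂ (orb x 1) (orb x' 0)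
      rw [hψ₂, mul_one] at ha hb
      simp only [hP₁, bondPair, sub_mulVec, dotProduct_sub]
      exact congrArg₂ (· - ·) ha hb
    have hP22 : ∀ y y', star Ψ ⬝ᵥ (bondPair (e₂ y) (e₂ y') *ᵥ Ψ) = P₂ y y' := by
      intro y y'
      have ha := dlsc_dotProduct_pair_high hO₁m hO₂m hO12 hOcov ψ₁ ψ₂ (orb y 0) (orb y' 1)
      have hb := dlsc_dotProduct_pair_high hO₁m hO₂m hO12 hOcov ψ₁ ψ₂ (orb y 1) (orb y' 0)
      rw [hψ₁, one_mul] at ha hb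
      simp only [hP₂, bondPair, sub_mulVec, dotProduct_sub]
      exact congrArg₂ (· - ·) ha hb
    -- the hopping sums
    set A₁ : ℂ := ∑ x, ∑ x', if G₁.Adj x x' then ∑ σ, F₁ x x' σ else 0 with hA₁
    set A₂ : ℂ := ∑ y, ∑ y', if G₂.Adj y y' then ∑ σ, F₂ y y' σ else 0 with hA₂
    set A₁₂ : ℂ := ∑ x, ∑ y, if G.Adj (e₁ x) (e₂ y) then
      ∑ σ, star (annihilation (orb (e₁ x) σ) *ᵥ Ψ) ⬝ᵥ (annihilation (orb (e₂ y) σ) *ᵥ Ψ) else 0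
      with hA₁₂
    set A₂₁ : ℂ := ∑ y, ∑ x, if G.Adj (e₂ y) (e₁ x) then
      ∑ σ, star (annihilation (orb (e₂ y) σ) *ᵥ Ψ) ⬝ᵥ (annihilation (orb (e₁ x) σ) *ᵥ Ψ) else 0
      with hA₂₁
    -- the chemical-potential sums
    set M₁ : ℂ := ∑ x, ∑ σ, F₁ x x σ with hM₁
    set M₂ : ℂ := ∑ y, ∑ σ, F₂ y y σ with hM₂
    -- the pair sums
    set S₁ : ℂ := ∑ x, ∑ x', ((W₁ x x' : ℝ) : ℂ) * (P₁ x x' + star (P₁ x x')) with hS₁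
    set S₂ : ℂ := ∑ y, ∑ y', ((W₂ y y' : ℝ) : ℂ) * (P₂ y y' + star (P₂ y y')) with hS₂
    set S₁₂ : ℂ := ∑ x, ∑ y, ((W (e₁ x) (e₂ y) : ℝ) : ℂ) *
      (star Ψ ⬝ᵥ (bondPair (e₁ x) (e₂ y) *ᵥ Ψ) + star (star Ψ ⬝ᵥ (bondPair (e₁ x) (e₂ y) *ᵥ Ψ)))
      with hS₁₂
    set S₂₁ : ℂ := ∑ y, ∑ x, ((W (e₂ y) (e₁ x) : ℝ) : ℂ) *
      (star Ψ ⬝ᵥ (bondPair (e₂ y) (e₁ x) *ᵥ Ψ) + star (star Ψ ⬝ᵥ (bondPair (e₂ y) (e₁ x) *ᵥ Ψ)))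
      with hS₂₁
    have hXA : (∑ p : Λ, ∑ q : Λ, ∑ σ : Fin 2,
        (if G.Adj p q then star (annihilation (orb p σ) *ᵥ Ψ) ⬝ᵥ (annihilation (orb q σ) *ᵥ Ψ)
          else 0)) = A₁ + A₁₂ + (A₂₁ + A₂) := by
      rw [sum_eq_sum_add_sum_of_cut he₁i he₂i hene hcov]
      congr 1
      · rw [hA₁, hA₁₂, ← Finset.sum_add_distrib]
        refine Finset.sum_congr rfl fun x _ => ?_
        rw [sum_eq_sum_add_sum_of_cut he₁i he₂i hene hcov]
        simp only [sum_ite_const_cond, hF11, hG₁]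
      · rw [hA₂₁, hA₂, ← Finset.sum_add_distrib]
        refine Finset.sum_congr rfl fun y _ => ?_
        rw [sum_eq_sum_add_sum_of_cut he₁i he₂i hene hcov]
        simp only [sum_ite_const_cond, hF22, hG₂]
    have hXD : (∑ p : Λ, star Ψ ⬝ᵥ (numberOp p 0 *ᵥ (numberOp p 1 *ᵥ Ψ))) =
        ∑ x, D₁ x + ∑ y, D₂ y := by
      rw [sum_eq_sum_add_sum_of_cut he₁i he₂i hene hcov]
      simp only [hD1, hD2]
    have hXM : (∑ p : Λ, ∑ σ : Fin 2,
        star (annihilation (orb p σ) *ᵥ Ψ) ⬝ᵥ (annihilation (orb p σ) *ᵥ Ψ)) = M₁ + M₂ := by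
      rw [sum_eq_sum_add_sum_of_cut he₁i he₂i hene hcov]
      simp only [hF11, hF22, hM₁, hM₂]
    have hXS : (∑ p : Λ, ∑ q : Λ, ((W p q : ℝ) : ℂ) *
        (star Ψ ⬝ᵥ (bondPair p q *ᵥ Ψ) + star (star Ψ ⬝ᵥ (bondPair p q *ᵥ Ψ)))) =
        S₁ + S₁₂ + (S₂₁ + S₂) := by
      rw [sum_eq_sum_add_sum_of_cut he₁i he₂i hene hcov]
      congr 1
      · rw [hS₁, hS₁₂, ← Finset.sum_add_distrib]
        refine Finset.sum_congr rfl fun x _ => ?_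
        rw [sum_eq_sum_add_sum_of_cut he₁i he₂i hene hcov]
        simp only [hP11, hW₁]
      · rw [hS₂₁, hS₂, ← Finset.sum_add_distrib]
        refine Finset.sum_congr rfl fun y _ => ?_
        rw [sum_eq_sum_add_sum_of_cut he₁i he₂i hene hcov]
        simp only [hP22, hW₂]
    have hbig : star Ψ ⬝ᵥ ((hamiltonianWith G t U μ -
        ∑ p : Λ, ∑ q : Λ, ((W p q : ℝ) : ℂ) • (bondPair p q + (bondPair p q)ᴴ)) *ᵥ Ψ) =
        -(t : ℂ) * (A₁ + A₁₂ + (A₂₁ + A₂)) + (U : ℂ) * (∑ x, D₁ x + ∑ y, D₂ y) -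
          (μ : ℂ) * (M₁ + M₂) - (S₁ + S₁₂ + (S₂₁ + S₂)) := by
      rw [dlsc_dotProduct_sourced_mulVec, hXA, hXD, hXM, hXS]
    have hone : star ψ₁ ⬝ᵥ ((hamiltonianWith G₁ t U μ -
        ∑ x : Λ₁, ∑ x' : Λ₁, ((W₁ x x' : ℝ) : ℂ) • (bondPair x x' + (bondPair x x')ᴴ)) *ᵥ ψ₁) =
        -(t : ℂ) * A₁ + (U : ℂ) * ∑ x, D₁ x - (μ : ℂ) * M₁ - S₁ := by
      rw [dlsc_dotProduct_sourced_mulVec]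
      simp only [sum_ite_const_cond, hA₁, hF₁, hD₁, hM₁, hS₁, hP₁]
    have htwo : star ψ₂ ⬝ᵥ ((hamiltonianWith G₂ t U μ -
        ∑ y : Λ₂, ∑ y' : Λ₂, ((W₂ y y' : ℝ) : ℂ) • (bondPair y y' + (bondPair y y')ᴴ)) *ᵥ ψ₂) =
        -(t : ℂ) * A₂ + (U : ℂ) * ∑ y, D₂ y - (μ : ℂ) * M₂ - S₂ := by
      rw [dlsc_dotProduct_sourced_mulVec]
      simp only [sum_ite_const_cond, hA₂, hF₂, hD₂, hM₂, hS₂, hP₂]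
    -- bounds on the cross terms
    have hbA₁₂ : ‖A₁₂‖ ≤ k * 2 := by
      rw [hA₁₂, ← Fintype.sum_prod_type']
      refine dlsc_norm_sum_le_of_card_le _ (fun pq : Λ₁ × Λ₂ => G.Adj (e₁ pq.1) (e₂ pq.2))
        (fun pq h => ?_) zero_le_two (fun pq h => ?_) hkG
      · by_contra hc; exact h (if_neg hc)
      · rw [if_pos h]; exact dlsc_norm_sum_hopAmp_le hΨ1 _ _
    have hbA₂₁ : ‖A₂₁‖ ≤ k * 2 := by
      rw [hA₂₁, ← Fintype.sum_prod_type']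
      refine dlsc_norm_sum_le_of_card_le _ (fun qp : Λ₂ × Λ₁ => G.Adj (e₂ qp.1) (e₁ qp.2))
        (fun qp h => ?_) zero_le_two (fun qp h => ?_) hkG'
      · by_contra hc; exact h (if_neg hc)
      · rw [if_pos h]; exact dlsc_norm_sum_hopAmp_le hΨ1 _ _
    have hbS₁₂ : ‖S₁₂‖ ≤ k * (w * 4) := by
      rw [hS₁₂, ← Fintype.sum_prod_type']
      refine dlsc_norm_sum_le_of_card_le _ (fun pq : Λ₁ × Λ₂ => W (e₁ pq.1) (e₂ pq.2) ≠ 0)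
        (fun pq h => ?_) (by positivity) (fun pq _ => ?_) hkW
      · intro hc; apply h; rw [hc, Complex.ofReal_zero, zero_mul]
      · exact (dlsc_norm_weight_mul_pairAmp_le hΨ1 _ _ _).trans
          (mul_le_mul_of_nonneg_right (hw _ _) (by norm_num))
    have hbS₂₁ : ‖S₂₁‖ ≤ k * (w * 4) := by
      rw [hS₂₁, ← Fintype.sum_prod_type']
      refine dlsc_norm_sum_le_of_card_le _ (fun qp : Λ₂ × Λ₁ => W (e₂ qp.1) (e₁ qp.2) ≠ 0)
        (fun qp h => ?_) (by positivity) (fun qp _ => ?_) hkW'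
      · intro hc; apply h; rw [hc, Complex.ofReal_zero, zero_mul]
      · exact (dlsc_norm_weight_mul_pairAmp_le hΨ1 _ _ _).trans
          (mul_le_mul_of_nonneg_right (hw _ _) (by norm_num))
    -- assemble
    have key : ∀ z : ℂ, (-(t : ℂ) * z).re ≤ |t| * ‖z‖ := fun z =>
      (Complex.re_le_norm _).trans (by rw [norm_mul, norm_neg, Complex.norm_real, Real.norm_eq_abs])
    have key' : ∀ z : ℂ, (-z).re ≤ ‖z‖ := fun z =>
      (Complex.re_le_norm _).trans (by rw [norm_neg])
    have hsplit : -(t : ℂ) * (A₁ + A₁₂ + (A₂₁ + A₂)) + (U : ℂ) * (∑ x, D₁ x + ∑ y, D₂ y) -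
          (μ : ℂ) * (M₁ + M₂) - (S₁ + S₁₂ + (S₂₁ + S₂)) =
        (-(t : ℂ) * A₁ + (U : ℂ) * ∑ x, D₁ x - (μ : ℂ) * M₁ - S₁) +
        (-(t : ℂ) * A₂ + (U : ℂ) * ∑ y, D₂ y - (μ : ℂ) * M₂ - S₂) +
          (-(t : ℂ) * A₁₂) + (-(t : ℂ) * A₂₁) + (-S₁₂) + (-S₂₁) := by ring
    rw [hbig, hsplit, Complex.add_re, Complex.add_re, Complex.add_re, Complex.add_re,
      Complex.add_re] at hE
    rw [hone, htwo]
    have h1 := key A₁₂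
    have h2 := key A₂₁
    have h3 := key' S₁₂
    have h4 := key' S₂₁
    have h5 : |t| * ‖A₁₂‖ ≤ |t| * (k * 2) := mul_le_mul_of_nonneg_left hbA₁₂ (abs_nonneg t)
    have h6 : |t| * ‖A₂₁‖ ≤ |t| * (k * 2) := mul_le_mul_of_nonneg_left hbA₂₁ (abs_nonneg t)
    nlinarith [hbS₁₂, hbS₂₁, h1, h2, h3, h4, h5, h6, hE]
  -- pass to the infima
  refine le_of_forall_pos_lt_add fun ε hε => ?_
  obtain ⟨ψ₁, hψ₁, hlt₁⟩ := dlsc_exists_unit_rayleigh_lt hHS₁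
    (b := (hamiltonianWith G₁ t U μ -
        ∑ x : Λ₁, ∑ x' : Λ₁, ((W₁ x x' : ℝ) : ℂ) • (bondPair x x' + (bondPair x x')ᴴ)).groundEnergy +
        ε / 2) (by linarith)
  obtain ⟨ψ₂, hψ₂, hlt₂⟩ := dlsc_exists_unit_rayleigh_lt hHS₂
    (b := (hamiltonianWith G₂ t U μ -
        ∑ y : Λ₂, ∑ y' : Λ₂, ((W₂ y y' : ℝ) : ℂ) • (bondPair y y' + (bondPair y y')ᴴ)).groundEnergy +
        ε / 2) (by linarith)
  have h := main ψ₁ ψ₂ hψ₁ hψ₂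
  linarith

end Cut

/-! ### Two pair-sourced Hamiltonians on a common site set -/

section Mismatch

variable {Λ : Type*} [LinearOrder Λ] [Fintype Λ]
variable (G G' : SimpleGraph Λ) [DecidableRel G.Adj] [DecidableRel G'.Adj]

/-- **Few mismatched bonds cost little.** On a common site set, if the adjacencies of `G` and `G'`
differ on at most `k` ordered pairs, and the pair weights `W`, `W'` differ on at most `k` ordered
pairs, by at most `w` each, then `E₀(H_{G,W}) ≤ E₀(H_{G',W'}) + (2|t| + 4w)k`: a unit near ground
state of `H_{G',W'}` is a trial state for `H_{G,W}`, and the two expectations differ only through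
the mismatched hopping amplitudes (`≤ 2|t|` each) and pair amplitudes (`≤ 4w` each).
Ruelle (1969) §2 (boundary-condition independence). [folklore] -/
theorem dlsc_groundEnergy_le_of_mismatch (W W' : Λ → Λ → ℝ) {k : ℕ}
    (hkG : #{pq : Λ × Λ | ¬ (G.Adj pq.1 pq.2 ↔ G'.Adj pq.1 pq.2)} ≤ k)
    (hkW : #{pq : Λ × Λ | W pq.1 pq.2 ≠ W' pq.1 pq.2} ≤ k) {w : ℝ} (hw0 : 0 ≤ w)
    (hw : ∀ p q, |W p q - W' p q| ≤ w) (t U μ : ℝ) :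
    (hamiltonianWith G t U μ -
        ∑ p : Λ, ∑ q : Λ, ((W p q : ℝ) : ℂ) • (bondPair p q + (bondPair p q)ᴴ)).groundEnergy ≤
      (hamiltonianWith G' t U μ -
        ∑ p : Λ, ∑ q : Λ, ((W' p q : ℝ) : ℂ) • (bondPair p q + (bondPair p q)ᴴ)).groundEnergy +
      (2 * |t| + 4 * w) * k := by
  have hHS := dlsc_isHermitian_sourced G W t U μ
  have hHS' := dlsc_isHermitian_sourced G' W' t U μ
  have main : ∀ ψ : Fock (Orb Λ), star ψ ⬝ᵥ ψ = 1 →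
      (hamiltonianWith G t U μ -
        ∑ p : Λ, ∑ q : Λ, ((W p q : ℝ) : ℂ) • (bondPair p q + (bondPair p q)ᴴ)).groundEnergy ≤
      (star ψ ⬝ᵥ ((hamiltonianWith G' t U μ -
        ∑ p : Λ, ∑ q : Λ, ((W' p q : ℝ) : ℂ) • (bondPair p q + (bondPair p q)ᴴ)) *ᵥ ψ)).re +
        (2 * |t| + 4 * w) * k := by
    intro ψ hψ
    have hE := groundEnergy_le_rayleigh_holds hHS ψ hψ
    set F : Λ → Λ → Fin 2 → ℂ := fun p q σ =>
      star (annihilation (orb p σ) *ᵥ ψ) ⬝ᵥ (annihilation (orb q σ) *ᵥ ψ) with hF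
    set P : Λ → Λ → ℂ := fun p q => star ψ ⬝ᵥ (bondPair p q *ᵥ ψ) with hP
    set A : ℂ := ∑ p, ∑ q, if G.Adj p q then ∑ σ, F p q σ else 0 with hA
    set A' : ℂ := ∑ p, ∑ q, if G'.Adj p q then ∑ σ, F p q σ else 0 with hA'
    set S : ℂ := ∑ p, ∑ q, ((W p q : ℝ) : ℂ) * (P p q + star (P p q)) with hS
    set S' : ℂ := ∑ p, ∑ q, ((W' p q : ℝ) : ℂ) * (P p q + star (P p q)) with hS'
    have h1 : star ψ ⬝ᵥ ((hamiltonianWith G t U μ -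
        ∑ p : Λ, ∑ q : Λ, ((W p q : ℝ) : ℂ) • (bondPair p q + (bondPair p q)ᴴ)) *ᵥ ψ) =
        -(t : ℂ) * A + (U : ℂ) * ∑ x, star ψ ⬝ᵥ (numberOp x 0 *ᵥ (numberOp x 1 *ᵥ ψ)) -
          (μ : ℂ) * ∑ x, ∑ σ, F x x σ - S := by
      rw [dlsc_dotProduct_sourced_mulVec]
      simp only [sum_ite_const_cond, hA, hF, hS, hP]
    have h2 : star ψ ⬝ᵥ ((hamiltonianWith G' t U μ -
        ∑ p : Λ, ∑ q : Λ, ((W' p q : ℝ) : ℂ) • (bondPair p q + (bondPair p q)ᴴ)) *ᵥ ψ) =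
        -(t : ℂ) * A' + (U : ℂ) * ∑ x, star ψ ⬝ᵥ (numberOp x 0 *ᵥ (numberOp x 1 *ᵥ ψ)) -
          (μ : ℂ) * ∑ x, ∑ σ, F x x σ - S' := by
      rw [dlsc_dotProduct_sourced_mulVec]
      simp only [sum_ite_const_cond, hA', hF, hS', hP]
    have hΔA : ‖A - A'‖ ≤ k * 2 :=
      norm_sum_ite_sub_sum_ite_le G.Adj G'.Adj (fun p q => ∑ σ, F p q σ) zero_le_two
        (fun p q => dlsc_norm_sum_hopAmp_le hψ p q) hkG
    have hΔS : ‖S - S'‖ ≤ k * (w * 4) := by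
      rw [hS, hS', ← Finset.sum_sub_distrib]
      simp only [← Finset.sum_sub_distrib, ← sub_mul, ← Complex.ofReal_sub]
      rw [← Fintype.sum_prod_type']
      refine dlsc_norm_sum_le_of_card_le _ (fun pq : Λ × Λ => W pq.1 pq.2 ≠ W' pq.1 pq.2)
        (fun pq h => ?_) (by positivity) (fun pq _ => ?_) hkW
      · intro hc; apply h; rw [hc, sub_self, Complex.ofReal_zero, zero_mul]
      · exact (dlsc_norm_weight_mul_pairAmp_le hψ _ _ _).trans
          (mul_le_mul_of_nonneg_right (hw _ _) (by norm_num))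
    have key : ∀ z : ℂ, (-(t : ℂ) * z).re ≤ |t| * ‖z‖ := fun z =>
      (Complex.re_le_norm _).trans (by rw [norm_mul, norm_neg, Complex.norm_real, Real.norm_eq_abs])
    have key' : ∀ z : ℂ, (-z).re ≤ ‖z‖ := fun z =>
      (Complex.re_le_norm _).trans (by rw [norm_neg])
    have hsplit : -(t : ℂ) * A + (U : ℂ) * ∑ x, star ψ ⬝ᵥ (numberOp x 0 *ᵥ (numberOp x 1 *ᵥ ψ)) -
          (μ : ℂ) * ∑ x, ∑ σ, F x x σ - S =
        (-(t : ℂ) * A' + (U : ℂ) * ∑ x, star ψ ⬝ᵥ (numberOp x 0 *ᵥ (numberOp x 1 *ᵥ ψ)) -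
          (μ : ℂ) * ∑ x, ∑ σ, F x x σ - S') + (-(t : ℂ) * (A - A')) + (-(S - S')) := by ring
    rw [h1, hsplit, Complex.add_re, Complex.add_re] at hE
    rw [h2]
    have h3 := key (A - A')
    have h4 := key' (S - S')
    have h5 : |t| * ‖A - A'‖ ≤ |t| * (k * 2) := mul_le_mul_of_nonneg_left hΔA (abs_nonneg t)
    nlinarith [hΔS, h3, h4, h5, hE]
  refine le_of_forall_pos_lt_add fun ε hε => ?_
  obtain ⟨ψ, hψ, hlt⟩ := dlsc_exists_unit_rayleigh_lt hHS'
    (b := (hamiltonianWith G' t U μ -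
        ∑ p : Λ, ∑ q : Λ, ((W' p q : ℝ) : ℂ) • (bondPair p q + (bondPair p q)ᴴ)).groundEnergy + ε)
    (by linarith)
  have h := main ψ hψ
  linarith

end Mismatch

end Summit.HubbardSuperconductivity.HubbardSuperconductivity.Theorems

end
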